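import Literature.Analysis.FluidPDE.PassiveVectorTensorTimeDilation
import HarnessLib

/-!
# Weak tensor-viscosity passive-vector solutions: the space–time pairing identity
# (`∫⟪w(t), Ψ(t)⟫` is absolutely continuous with the weak integrand as derivative)

Analysis/FluidPDE proof-support file (everything proved; no definitions, no named facts).  For a weak solution `w` of
`∂ₜw + (b·∇)w + A (w·∇)b + ∇π = 𝓛_𝔸 w`, `∇·w = 0` on `T^d × [0,T)` (class `Torus.IsWeakTensorPassiveVectorOn A T 𝔸 b w₀ w`)
and a divergence-free space–time test field `Ψ` on `[0,T)`:

* `IsWeakTensorPassiveVectorOn.setIntegral_test_smul_spaceTime` — the weak formulation tested with `η(t) • Ψ(t, x)` for a smooth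
  compactly supported time profile `η` with `tsupport η ⊆ (−∞, T)`:
  `∫_{(0,T)} (η' ∫⟪w, Ψ⟫ + η ∫(⟪w, ∂ₜΨ + (b·∇)Ψ + 𝓛_𝔸^*Ψ⟫ + A⟪b, (w·∇)Ψ⟫)) + η(0) ∫⟪w₀, Ψ(0)⟫ = 0`;
* `IsWeakTensorPassiveVectorOn.ae_integral_inner_spaceTime_eq` — consequently (a.e. du Bois-Reymond lemma with datum), for
  a.e. `t ∈ (0,T)`:
  `∫⟪w(t), Ψ(t)⟫ = ∫⟪w₀, Ψ(0)⟫ + ∫_{(0,t]} ∫(⟪w, ∂ₜΨ + (b·∇)Ψ + 𝓛_𝔸^*Ψ⟫ + A⟪b, (w·∇)Ψ⟫)`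
  (the space–time companion of the steady `PassiveVectorTensorClass.ae_integral_inner_eq`; DiPerna–Lions 1989 (13)–(14)).

Consumer: the RESTART (time translation from a trace datum) of weak tensor solutions, the window bookkeeping of the K1L
one-level lemma `stub_oneLevelL` (route `SolenoidalFractalHomogenisation`, cell `ad-ideate`).

## References

* R. J. DiPerna, P.-L. Lions, *Ordinary differential equations, transport theory and Sobolev spaces*, Invent. Math. 98
  (1989), §II.1 (12)–(14). [`DiPernaLions1989`]
* R. Temam, *Navier–Stokes Equations* (1984), Ch. III §1.1 (test functions; (1.11)). [`Temam1984`]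
-/

noncomputable section

open MeasureTheory Set Filter Function
open scoped ENNReal NNReal InnerProductSpace ContDiff

namespace Literature.Analysis.FluidPDE

namespace Torus

variable {d : Type*} [Fintype d] [DecidableEq d]

/-! ## Time profiles times space–time test fields -/

section SmulSpaceTime

variable {T : ℝ} {η : ℝ → ℝ} {Ψ : ℝ → UnitAddTorus d → EuclideanSpace ℝ d}

/-- A constant multiple of a divergence-free field is divergence free. [cite: Temam1984, Ch. III §1.1] -/
theorem isDivFree_const_smul_field {G : UnitAddTorus d → EuclideanSpace ℝ d}
    (hG : FunctionSpaces.Torus.IsDivFree G) (c : ℝ) : FunctionSpaces.Torus.IsDivFree (c • G) := by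
  intro x
  have h : ∀ i : d, FunctionSpaces.Torus.partialDeriv i (fun y => (c • G) y i) x =
      c * FunctionSpaces.Torus.partialDeriv i (fun y => G y i) x := by
    intro i
    have e : (fun y => (c • G) y i) = fun y => c * G y i := by
      funext y; simp [Pi.smul_apply, smul_eq_mul]
    rw [e]
    simp only [FunctionSpaces.Torus.partialDeriv, FunctionSpaces.Torus.lineDeriv, deriv_const_mul_field']
  unfold FunctionSpaces.Torus.divergence
  simp_rw [h]
  rw [← Finset.mul_sum]
  have h0 := hG x
  unfold FunctionSpaces.Torus.divergence at h0
  rw [h0, mul_zero]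

omit [DecidableEq d] in
/-- `(u·∇)(c • G) = c • (u·∇)G` for a `C¹` field. [cite: Temam1984, Ch. III §1.1] -/
theorem convect_const_smul_field {F : Type*} [NormedAddCommGroup F] [NormedSpace ℝ F]
    {G : UnitAddTorus d → F} (hG : FunctionSpaces.Torus.IsContDiff 1 G) (u : UnitAddTorus d → EuclideanSpace ℝ d) (c : ℝ)
    (x : UnitAddTorus d) : FunctionSpaces.Torus.convect u (c • G) x = c • FunctionSpaces.Torus.convect u G x := by
  simp only [FunctionSpaces.Torus.convect]
  rw [FunctionSpaces.Torus.fderiv_const_smul hG]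
  rfl

omit [DecidableEq d] in
/-- **A time profile times a space–time test field is a space–time test field.** [cite: Temam1984, Ch. III §1.1] -/
theorem isSpaceTimeTest_smul_spaceTime (hη : ContDiff ℝ ∞ η) (hΨ : FunctionSpaces.Torus.IsSpaceTimeTest T Ψ) :
    FunctionSpaces.Torus.IsSpaceTimeTest T (fun t x => η t • Ψ t x) := by
  obtain ⟨hs, T₁, hT₁, h0⟩ := hΨ
  refine ⟨?_, T₁, hT₁, fun t ht => ?_⟩
  · have e : FunctionSpaces.Torus.stLift (fun t x => η t • Ψ t x) =
        fun p : ℝ × EuclideanSpace ℝ d => η p.1 • FunctionSpaces.Torus.stLift Ψ p := by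
      funext p; rfl
    rw [e]
    exact (hη.comp contDiff_fst).smul hs
  · funext x
    show η t • Ψ t x = 0
    rw [h0 t ht]
    simp

omit [DecidableEq d] in
/-- Product rule in time: `∂ₜ(η • Ψ) = η' • Ψ + η • ∂ₜΨ`. [cite: Temam1984, Ch. III §1.1] -/
theorem timeDeriv_smul_spaceTime (hη : ContDiff ℝ ∞ η) (hΨ : FunctionSpaces.Torus.IsSpaceTimeTest T Ψ) (t : ℝ)
    (x : UnitAddTorus d) :
    FunctionSpaces.Torus.timeDeriv (fun t x => η t • Ψ t x) t x =
      deriv η t • Ψ t x + η t • FunctionSpaces.Torus.timeDeriv Ψ t x := by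
  have hη' : HasDerivAt η (deriv η t) t := ((hη.differentiable (by simp)) t).hasDerivAt
  have h : HasDerivAt (fun τ => η τ • Ψ τ x) (η t • FunctionSpaces.Torus.timeDeriv Ψ t x + deriv η t • Ψ t x) t :=
    hη'.smul (IsSpaceTimeTest.hasDerivAt_slice hΨ x t)
  simp only [FunctionSpaces.Torus.timeDeriv] at h ⊢
  rw [h.deriv, add_comm]

end SmulSpaceTime

namespace IsWeakTensorPassiveVectorOn

variable {A T : ℝ} {𝔸 : Visc4 d} {b w : ℝ → UnitAddTorus d → EuclideanSpace ℝ d}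
  {w₀ : UnitAddTorus d → EuclideanSpace ℝ d} {Ψ : ℝ → UnitAddTorus d → EuclideanSpace ℝ d}

/-- **The weak formulation tested with `η(t) • Ψ(t, x)`.**  For a smooth compactly supported `η` with `tsupport η ⊆ (−∞, T)`
and a divergence-free space–time test field `Ψ` on `[0,T)`:
`∫_{(0,T)} (η'(t) ∫⟪w(t), Ψ(t)⟫ + η(t) ∫(⟪w(t), ∂ₜΨ(t) + (b(t)·∇)Ψ(t) + 𝓛_𝔸^*Ψ(t)⟫ + A⟪b(t), (w(t)·∇)Ψ(t)⟫)) dt + η(0) ∫⟪w₀, Ψ(0)⟫ = 0`.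
[cite: DiPernaLions1989, §II.1 (13)–(14)] [cite: Temam1984, Ch. III §1.1] -/
theorem setIntegral_test_smul_spaceTime (h : IsWeakTensorPassiveVectorOn A T 𝔸 b w₀ w) {η : ℝ → ℝ}
    (hη : ContDiff ℝ ∞ η) (hηc : HasCompactSupport η) (hηT : tsupport η ⊆ Iio T)
    (hΨ : FunctionSpaces.Torus.IsSpaceTimeTest T Ψ) (hΨdiv : ∀ t, FunctionSpaces.Torus.IsDivFree (Ψ t)) :
    (∫ t in Ioo 0 T, ((deriv η t * ∫ x, ⟪w t x, Ψ t x⟫_ℝ) +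
      η t * ∫ x, (⟪w t x, FunctionSpaces.Torus.timeDeriv Ψ t x +
          FunctionSpaces.Torus.convect (b t) (Ψ t) x + viscAdj 𝔸 (Ψ t) x⟫_ℝ +
        A * ⟪b t x, FunctionSpaces.Torus.convect (w t) (Ψ t) x⟫_ℝ))) +
      η 0 * ∫ x, ⟪w₀ x, Ψ 0 x⟫_ℝ = 0 := by
  have _ := hηT
  have _ := hηc
  have hΨ' := isSpaceTimeTest_smul_spaceTime hη hΨ
  have hΨ1 : ∀ t, FunctionSpaces.Torus.IsContDiff 1 (Ψ t) := fun t => (hΨ.isSmooth_slice t).isContDiff (by simp)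
  have hΨ'div : ∀ t, FunctionSpaces.Torus.IsDivFree ((fun t x => η t • Ψ t x) t) := fun t => by
    rw [show ((fun t x => η t • Ψ t x) t) = η t • Ψ t from rfl]
    exact isDivFree_const_smul_field (hΨdiv t) (η t)
  have key := h.integral_prod_weak_eq hΨ' hΨ'div
  set P : Measure (ℝ × UnitAddTorus d) := ((volume : Measure ℝ).restrict (Ioo 0 T)).prod volume with hP
  -- pointwise form of the integrand
  have hpt : ∀ p : ℝ × UnitAddTorus d,
      ⟪w p.1 p.2, FunctionSpaces.Torus.timeDeriv (fun t x => η t • Ψ t x) p.1 p.2 +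
          FunctionSpaces.Torus.convect (b p.1) ((fun t x => η t • Ψ t x) p.1) p.2 +
          viscAdj 𝔸 ((fun t x => η t • Ψ t x) p.1) p.2⟫_ℝ +
        A * ⟪b p.1 p.2, FunctionSpaces.Torus.convect (w p.1) ((fun t x => η t • Ψ t x) p.1) p.2⟫_ℝ =
      deriv η p.1 * ⟪w p.1 p.2, Ψ p.1 p.2⟫_ℝ +
        η p.1 * (⟪w p.1 p.2, FunctionSpaces.Torus.timeDeriv Ψ p.1 p.2 +
            FunctionSpaces.Torus.convect (b p.1) (Ψ p.1) p.2 + viscAdj 𝔸 (Ψ p.1) p.2⟫_ℝ +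
          A * ⟪b p.1 p.2, FunctionSpaces.Torus.convect (w p.1) (Ψ p.1) p.2⟫_ℝ) := by
    intro p
    rw [timeDeriv_smul_spaceTime hη hΨ,
      show (fun t x => η t • Ψ t x) p.1 = η p.1 • Ψ p.1 from rfl,
      convect_const_smul_field (hΨ1 p.1), convect_const_smul_field (hΨ1 p.1),
      viscAdj_const_smul_field 𝔸 (hΨ.isSmooth_slice p.1)]
    simp only [inner_add_right, inner_smul_right]
    ring
  obtain ⟨Ca, hCa⟩ := (hη.continuous_deriv (by simp)).bounded_above_of_compact_support hηc.deriv
  obtain ⟨Cb, hCb⟩ := hη.continuous.bounded_above_of_compact_support hηc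
  set f₁ : ℝ × UnitAddTorus d → ℝ := fun p => deriv η p.1 * ⟪w p.1 p.2, Ψ p.1 p.2⟫_ℝ with hf₁
  set f₂ : ℝ × UnitAddTorus d → ℝ := fun p =>
    η p.1 * (⟪w p.1 p.2, FunctionSpaces.Torus.timeDeriv Ψ p.1 p.2 +
        FunctionSpaces.Torus.convect (b p.1) (Ψ p.1) p.2 + viscAdj 𝔸 (Ψ p.1) p.2⟫_ℝ +
      A * ⟪b p.1 p.2, FunctionSpaces.Torus.convect (w p.1) (Ψ p.1) p.2⟫_ℝ) with hf₂
  have hΨc : Continuous (uncurry Ψ) := FunctionSpaces.Torus.continuous_uncurry_of_continuous_stLift hΨ.1.continuous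
  have hI₁ := h.integrable_inner_of_continuous hΨc
  have hI₂ := h.integrable_weakIntegrand hΨ
  have hf₁i : Integrable f₁ P :=
    hI₁.bdd_mul ((hη.continuous_deriv (by simp)).comp continuous_fst).aestronglyMeasurable
      (Eventually.of_forall fun p => hCa p.1)
  have hf₂i : Integrable f₂ P :=
    hI₂.bdd_mul (hη.continuous.comp continuous_fst).aestronglyMeasurable (Eventually.of_forall fun p => hCb p.1)
  have esum : (∫ p, (f₁ p + f₂ p) ∂P) + η 0 * ∫ x, ⟪w₀ x, Ψ 0 x⟫_ℝ = 0 := by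
    have e1 : ∫ p, (f₁ p + f₂ p) ∂P = ∫ p,
        (⟪w p.1 p.2, FunctionSpaces.Torus.timeDeriv (fun t x => η t • Ψ t x) p.1 p.2 +
            FunctionSpaces.Torus.convect (b p.1) ((fun t x => η t • Ψ t x) p.1) p.2 +
            viscAdj 𝔸 ((fun t x => η t • Ψ t x) p.1) p.2⟫_ℝ +
          A * ⟪b p.1 p.2, FunctionSpaces.Torus.convect (w p.1) ((fun t x => η t • Ψ t x) p.1) p.2⟫_ℝ) ∂P :=
      integral_congr_ae (Eventually.of_forall fun p => (hpt p).symm)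
    have e2 : η 0 * ∫ x, ⟪w₀ x, Ψ 0 x⟫_ℝ = ∫ x, ⟪w₀ x, (fun t x => η t • Ψ t x) 0 x⟫_ℝ := by
      rw [← integral_const_mul]
      exact integral_congr_ae (Eventually.of_forall fun x => by simp only [inner_smul_right])
    rw [e1, e2]
    exact key
  have e₁ : ∫ p, f₁ p ∂P = ∫ t in Ioo 0 T, deriv η t * ∫ x, ⟪w t x, Ψ t x⟫_ℝ := by
    rw [hP, integral_prod _ hf₁i]
    refine integral_congr_ae (Eventually.of_forall fun t => ?_)
    simp only [hf₁]
    exact integral_const_mul _ _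
  have e₂ : ∫ p, f₂ p ∂P = ∫ t in Ioo 0 T, η t * ∫ x, (⟪w t x, FunctionSpaces.Torus.timeDeriv Ψ t x +
        FunctionSpaces.Torus.convect (b t) (Ψ t) x + viscAdj 𝔸 (Ψ t) x⟫_ℝ +
      A * ⟪b t x, FunctionSpaces.Torus.convect (w t) (Ψ t) x⟫_ℝ) := by
    rw [hP, integral_prod _ hf₂i]
    refine integral_congr_ae (Eventually.of_forall fun t => ?_)
    simp only [hf₂]
    exact integral_const_mul _ _
  have ha : Integrable (fun t => deriv η t * ∫ x, ⟪w t x, Ψ t x⟫_ℝ) (volume.restrict (Ioo 0 T)) := by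
    refine hf₁i.integral_prod_left.congr (Eventually.of_forall fun t => ?_)
    simp only [hf₁]
    exact integral_const_mul _ _
  have hb : Integrable (fun t => η t * ∫ x, (⟪w t x, FunctionSpaces.Torus.timeDeriv Ψ t x +
        FunctionSpaces.Torus.convect (b t) (Ψ t) x + viscAdj 𝔸 (Ψ t) x⟫_ℝ +
      A * ⟪b t x, FunctionSpaces.Torus.convect (w t) (Ψ t) x⟫_ℝ)) (volume.restrict (Ioo 0 T)) := by
    refine hf₂i.integral_prod_left.congr (Eventually.of_forall fun t => ?_)
    simp only [hf₂]
    exact integral_const_mul _ _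
  rw [integral_add hf₁i hf₂i, e₁, e₂, ← integral_add ha hb] at esum
  exact esum

/-- **A weak solution paired with a divergence-free space–time test field is absolutely continuous in time**: for a.e.
`t ∈ (0,T)`,
`∫⟪w(t), Ψ(t)⟫ = ∫⟪w₀, Ψ(0)⟫ + ∫_{(0,t]} ∫(⟪w(τ), ∂ₜΨ(τ) + (b(τ)·∇)Ψ(τ) + 𝓛_𝔸^*Ψ(τ)⟫ + A⟪b(τ), (w(τ)·∇)Ψ(τ)⟫) dτ`
(`setIntegral_test_smul_spaceTime` and the a.e. du Bois-Reymond lemma with datum; the space–time companion of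
`ae_integral_inner_eq`). [cite: DiPernaLions1989, §II.1 (13)–(14)] -/
theorem ae_integral_inner_spaceTime_eq (h : IsWeakTensorPassiveVectorOn A T 𝔸 b w₀ w)
    (hΨ : FunctionSpaces.Torus.IsSpaceTimeTest T Ψ) (hΨdiv : ∀ t, FunctionSpaces.Torus.IsDivFree (Ψ t)) :
    ∀ᵐ t ∂(volume.restrict (Ioo 0 T)),
      ∫ x, ⟪w t x, Ψ t x⟫_ℝ = (∫ x, ⟪w₀ x, Ψ 0 x⟫_ℝ) +
        ∫ τ in Ioc 0 t, ∫ x, (⟪w τ x, FunctionSpaces.Torus.timeDeriv Ψ τ x +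
            FunctionSpaces.Torus.convect (b τ) (Ψ τ) x + viscAdj 𝔸 (Ψ τ) x⟫_ℝ +
          A * ⟪b τ x, FunctionSpaces.Torus.convect (w τ) (Ψ τ) x⟫_ℝ) := by
  have hΨc : Continuous (uncurry Ψ) := FunctionSpaces.Torus.continuous_uncurry_of_continuous_stLift hΨ.1.continuous
  have hU : IntegrableOn (fun t => ∫ x, ⟪w t x, Ψ t x⟫_ℝ) (Ioo 0 T) volume :=
    (h.integrable_inner_of_continuous hΨc).integral_prod_left
  have hF : IntegrableOn (fun t => ∫ x, (⟪w t x, FunctionSpaces.Torus.timeDeriv Ψ t x +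
        FunctionSpaces.Torus.convect (b t) (Ψ t) x + viscAdj 𝔸 (Ψ t) x⟫_ℝ +
      A * ⟪b t x, FunctionSpaces.Torus.convect (w t) (Ψ t) x⟫_ℝ)) (Ioo 0 T) volume :=
    (h.integrable_weakIntegrand hΨ).integral_prod_left
  exact FunctionSpaces.ae_eq_add_setIntegral_of_forall_test hU hF fun η hη hηc hηT =>
    h.setIntegral_test_smul_spaceTime hη hηc hηT hΨ hΨdiv

end IsWeakTensorPassiveVectorOn

end Torus

end Literature.Analysis.FluidPDE

end
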